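import Mathlib
import HarnessLib
import Summits.HubbardSuperconductivity.HubbardSuperconductivity.Theorems.KLProgrammeKLRegimeEngineSliceIncrementFlow
import Summits.HubbardSuperconductivity.HubbardSuperconductivity.Theorems.KLProgrammeKLRegimeSectorSliceRowsTelescope
import Summits.HubbardSuperconductivity.HubbardSuperconductivity.Theorems.KLProgrammeKLRegimeEngineScaleWtSliceRows

/-!
# KL programme — K3 ENGINE child (`KLRegimeEngineV17F2`, stmt-HubbardSuperconductivity-20437), stub (b) weighted lines, cure (c-D): the weighted rows
# of the sectorised slice covariance at the END of the flow chain `K_{m₀} → … → K_{m₀+d}` — BASE + a LINEAR-in-`d` sum of `m`-free increments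

Cell `gate-hubbard-kl`, seat hubbard-kl-k3c3-p2 (g9); v2 conditional token #19 `klWtBudget ↦ klWtBudget·klWtAllow`; located risk «(b)-Wt@j≥1», evidence
#48 CD-LIMITS (§0 line 1, §1).  This is the (c-D) flow-piece telescoping of Benfatto–Giuliani–Mastropietro 2006 §3 (3.2)–(3.8) for the WEIGHTED rows
of `Sᵀ(F)·C^{K_n}_{(Λ,Λ′]}·S(F)` in the moment weight `w_S(z) = 1 + s₀|z̃₁| + S(|z̃₂,₁| + |z̃₂,₂|)` of the level (`…EngineScaleWtSliceRows`:
`S = Λ_j`, `s₀ = Λ_jβ/(2M)` turns `klScaleWt_j`-rows into this form):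

* `…SectorSliceRowsTelescope.rowSumWt_norm_sectorSliceCT_le_telescope` splits the rows at `K_{m₀+d}` into the BASE rows at `K_{m₀}` (left raw here —
  the derivative-route instance at the harmless depth `m₀(j)` is the p3 lineage's) plus the `d` increments;
* each increment `(K_m, K_{m+1})`, `m = m₀ + i`, is bounded by `…EngineSliceIncrementFlow.sliceIncrPairWt_flow_le` at ITS OWN weight rate `ρ/4^m`,
  after the weight comparison `w_S ≤ (S4^m/ρ)·w_{ρ/4^m}` (`ρ ≤ S·4^{m₀}`): the factors `4^m · 4^m / 16^m` cancel and every piece costs the SAME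
  `m`-free amount `(S/ρ)·√(524288(1/s₀+1)[(1+4√2)²(2√2/ρ+2)(2√2/ρ₃+2) + (1/ρ+1)²])·√(24·2M·L²·N_s(ω,ω′))·2c₀K₁G₀`;
* the five threshold conditions are monotone in `m`, so they are asked ONCE, at `m₀`.

* **`rowSumWt_flow_telescope_le`** — `Σ_{Y′} ‖(SᵀC^{K_{m₀+d}}S) Y Y′‖·w_S(x−x′) ≤ [base rows at K_{m₀}] + d · 8·Σ_{ω′} (S/ρ)·Π̂·√(24·2M·L²·N_s(ω,ω′))·2c₀K₁G₀`.
  This is the honest LINEAR form of token #19's allowance (CD-LIMITS: `m`-independent per-piece cost; `d = n − m₀(j)` pieces above the harmless depth).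

Everything is proved; no definitions, no sorry.  Nothing asserts superconductivity.
-/

noncomputable section

namespace Summit.HubbardSuperconductivity.HubbardSuperconductivity.Theorems.EngineV8

set_option linter.dupNamespace false -- summit = problem name (single-conjunct summit), D-0017

open Real Finset Literature.MathematicalPhysics.QuantumLattice Literature.Probability.LatticeModels
open Summit.HubbardSuperconductivity.HubbardSuperconductivity.Theorems.DispersionFlow
open Summit.HubbardSuperconductivity.HubbardSuperconductivity.Theorems.KLRegimeSplit
open Summit.HubbardSuperconductivity.HubbardSuperconductivity.Theorems.TorusFourierL2

variable {L M : ℕ} [NeZero L] [NeZero M]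

omit [NeZero L] [NeZero M] in
/-- The per-piece cancellation `(S/(ρ/x))·(x·R·Q·2c(K(G/x²))) = (S/ρ)·R·Q·2c(KG)` (`ρ, x ≠ 0`). -/
theorem incr_prefactor_cancel {S ρ x R' Q c K G : ℝ} (hρ : ρ ≠ 0) (hx : x ≠ 0) :
    S / (ρ / x) * (x * R' * Q * (2 * (c * (K * (G / x ^ 2))))) = S / ρ * R' * Q * (2 * (c * (K * G))) := by
  field_simp

omit [NeZero L] in
/-- **Weight comparison**: for `0 < s ≤ S`, `1 + s₀|t| + S(|x₀|+|x₁|) ≤ (S/s)·(1 + s₀|t| + s(|x₀|+|x₁|))` (`s₀ ≥ 0`). -/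
theorem momentWt_le_ratio_mul {P : ℕ} {s₀ s S : ℝ} (hs₀ : 0 ≤ s₀) (hs : 0 < s) (hsS : s ≤ S) (z : TorusSite 1 P × TorusSite 2 L) :
    (1 + s₀ * |(((z.1 0).valMinAbs : ℤ) : ℝ)| + S * |(((z.2 0).valMinAbs : ℤ) : ℝ)| + S * |(((z.2 1).valMinAbs : ℤ) : ℝ)|) ≤
      S / s * (1 + s₀ * |(((z.1 0).valMinAbs : ℤ) : ℝ)| + s * |(((z.2 0).valMinAbs : ℤ) : ℝ)| + s * |(((z.2 1).valMinAbs : ℤ) : ℝ)|) := by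
  have h1 : 1 ≤ S / s := by rwa [le_div_iff₀ hs, one_mul]
  have ht : 0 ≤ s₀ * |(((z.1 0).valMinAbs : ℤ) : ℝ)| := by positivity
  have hx0 : 0 ≤ |(((z.2 0).valMinAbs : ℤ) : ℝ)| := abs_nonneg _
  have hx1 : 0 ≤ |(((z.2 1).valMinAbs : ℤ) : ℝ)| := abs_nonneg _
  have e : S / s * (1 + s₀ * |(((z.1 0).valMinAbs : ℤ) : ℝ)| + s * |(((z.2 0).valMinAbs : ℤ) : ℝ)| + s * |(((z.2 1).valMinAbs : ℤ) : ℝ)|) =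
      S / s * (1 + s₀ * |(((z.1 0).valMinAbs : ℤ) : ℝ)|) + S * |(((z.2 0).valMinAbs : ℤ) : ℝ)| + S * |(((z.2 1).valMinAbs : ℤ) : ℝ)| := by
    field_simp
  rw [e]
  nlinarith only [h1, ht, hx0, hx1]

/-- **The weighted rows at the end of the flow chain: base + `d` equal `m`-free increments** (see the module docstring).
[cite: BenfattoGiulianiMastropietro2006, §2.7 (2.66)–(2.67), §3 (3.2)–(3.8)] -/
theorem rowSumWt_flow_telescope_le {β U μ Λ Λ' : ℝ} {R : RenConsts} {N : ℕ} (hβ : 0 < β) (hΛ : 0 < Λ) (hΛΛ' : Λ ≤ Λ')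
    (hM : Λ' < π * (2 * M - 5) / β) (hR : ∀ j, 0 ≤ R.Gfr j) {m₀ d : ℕ} (hJ : ∀ m' < m₀ + d, FlowPieceJetsAt L M β U μ R m')
    {G₀ G₁ G₂ G₃ b₁ b₂ b₂' b₃ b₃' : ℝ} (hG₀ : G₀ = R.Gfr 0 * uPow 0 U) (hG₁ : G₁ = R.Gfr 1 * uPow 1 U) (hG₂ : G₂ = R.Gfr 2 * uPow 2 U)
    (hG₃ : G₃ = R.Gfr 3 * uPow 3 U) (hb₁ : b₁ = 4 + 4 / 3 * (R.Gfr 1 * uPow 1 U)) (hb₂ : b₂ = 16) (hb₂' : b₂' = R.Gfr 2 * uPow 2 U)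
    (hb₃ : b₃ = 64) (hb₃' : b₃' = R.Gfr 3 * uPow 3 U / 3)
    {B₁ B₂ B₃ B₄ : ℝ} (hB₁ : ∀ x, |deriv salmhoferCutoff x| ≤ B₁) (hB₂ : ∀ x, |deriv (deriv salmhoferCutoff) x| ≤ B₂)
    (hB₃ : ∀ x, |deriv (deriv (deriv salmhoferCutoff)) x| ≤ B₃) (hB₄ : ∀ x, |deriv (deriv (deriv (deriv salmhoferCutoff))) x| ≤ B₄)
    -- the sector multipliers: per pair, sup, support, time differences, space differences in scale form
    (F : Fin N → FreqMomentum L M → ℂ) (hF0 : ∀ ω ω' (q : TorusSite 1 (2 * M) × TorusSite 2 L), ‖F ω (⟨(q.1 0).val, ZMod.val_lt (q.1 0)⟩, q.2) * F ω' (⟨(q.1 0).val, ZMod.val_lt (q.1 0)⟩, q.2)‖ ≤ 1)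
    {Ns : Fin N → Fin N → ℕ} (hsupp : ∀ ω ω', (univ.filter fun q : TorusSite 1 (2 * M) × TorusSite 2 L => F ω (⟨(q.1 0).val, ZMod.val_lt (q.1 0)⟩, q.2) * F ω' (⟨(q.1 0).val, ZMod.val_lt (q.1 0)⟩, q.2) ≠ 0).card ≤ Ns ω ω')
    (v : Fin N → Fin 2 → ℤ) (hv : ∀ ω, v ω ≠ 0)
    {at₁ at₂ at₃ : ℝ} (hat₁ : 0 ≤ at₁) (hat₂ : 0 ≤ at₂) (hat₃ : 0 ≤ at₃)
    (hMt₁ : ∀ ω ω' q, ‖fwdDiff ((fun _ : Fin 1 => (1 : ZMod (2 * M))), (0 : TorusSite 2 L)) (fun q : TorusSite 1 (2 * M) × TorusSite 2 L => F ω (⟨(q.1 0).val, ZMod.val_lt (q.1 0)⟩, q.2) * F ω' (⟨(q.1 0).val, ZMod.val_lt (q.1 0)⟩, q.2)) q‖ ≤ at₁)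
    (hMt₂ : ∀ ω ω' q, ‖(fwdDiff ((fun _ : Fin 1 => (1 : ZMod (2 * M))), (0 : TorusSite 2 L)))^[2] (fun q : TorusSite 1 (2 * M) × TorusSite 2 L => F ω (⟨(q.1 0).val, ZMod.val_lt (q.1 0)⟩, q.2) * F ω' (⟨(q.1 0).val, ZMod.val_lt (q.1 0)⟩, q.2)) q‖ ≤ at₂)
    (hMt₃ : ∀ ω ω' q, ‖(fwdDiff ((fun _ : Fin 1 => (1 : ZMod (2 * M))), (0 : TorusSite 2 L)))^[3] (fun q : TorusSite 1 (2 * M) × TorusSite 2 L => F ω (⟨(q.1 0).val, ZMod.val_lt (q.1 0)⟩, q.2) * F ω' (⟨(q.1 0).val, ZMod.val_lt (q.1 0)⟩, q.2)) q‖ ≤ at₃)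
    {α₁ α₂ α₃ : ℝ} (hα₁ : 0 ≤ α₁) (hα₂ : 0 ≤ α₂) (hα₃ : 0 ≤ α₃)
    (hMe₁ : ∀ ω ω' q (i : Fin 2), ‖fwdDiff ((0 : TorusSite 1 (2 * M)), (Pi.single i (1 : ZMod L) : TorusSite 2 L)) (fun q : TorusSite 1 (2 * M) × TorusSite 2 L => F ω (⟨(q.1 0).val, ZMod.val_lt (q.1 0)⟩, q.2) * F ω' (⟨(q.1 0).val, ZMod.val_lt (q.1 0)⟩, q.2)) q‖ ≤
      α₁ * ‖(WithLp.toLp 2 (fun j => 2 * π / L * ((Pi.single i (1 : ℤ) : Fin 2 → ℤ) j : ℝ)) : EuclideanSpace ℝ (Fin 2))‖)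
    (hMe₂ : ∀ ω ω' q (i : Fin 2), ‖(fwdDiff ((0 : TorusSite 1 (2 * M)), (Pi.single i (1 : ZMod L) : TorusSite 2 L)))^[2] (fun q : TorusSite 1 (2 * M) × TorusSite 2 L => F ω (⟨(q.1 0).val, ZMod.val_lt (q.1 0)⟩, q.2) * F ω' (⟨(q.1 0).val, ZMod.val_lt (q.1 0)⟩, q.2)) q‖ ≤
      α₂ * ‖(WithLp.toLp 2 (fun j => 2 * π / L * ((Pi.single i (1 : ℤ) : Fin 2 → ℤ) j : ℝ)) : EuclideanSpace ℝ (Fin 2))‖ ^ 2)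
    (hMe₃ : ∀ ω ω' q (i : Fin 2), ‖(fwdDiff ((0 : TorusSite 1 (2 * M)), (Pi.single i (1 : ZMod L) : TorusSite 2 L)))^[3] (fun q : TorusSite 1 (2 * M) × TorusSite 2 L => F ω (⟨(q.1 0).val, ZMod.val_lt (q.1 0)⟩, q.2) * F ω' (⟨(q.1 0).val, ZMod.val_lt (q.1 0)⟩, q.2)) q‖ ≤
      α₃ * ‖(WithLp.toLp 2 (fun j => 2 * π / L * ((Pi.single i (1 : ℤ) : Fin 2 → ℤ) j : ℝ)) : EuclideanSpace ℝ (Fin 2))‖ ^ 3)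
    (hMn₁ : ∀ ω ω' q, ‖fwdDiff ((0 : TorusSite 1 (2 * M)), (fun j => ((![-(v ω) 1, (v ω) 0] j : ℤ) : ZMod L))) (fun q : TorusSite 1 (2 * M) × TorusSite 2 L => F ω (⟨(q.1 0).val, ZMod.val_lt (q.1 0)⟩, q.2) * F ω' (⟨(q.1 0).val, ZMod.val_lt (q.1 0)⟩, q.2)) q‖ ≤
      α₁ * ‖(WithLp.toLp 2 (fun j => 2 * π / L * ((![-(v ω) 1, (v ω) 0] : Fin 2 → ℤ) j : ℝ)) : EuclideanSpace ℝ (Fin 2))‖)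
    (hMn₂ : ∀ ω ω' q, ‖(fwdDiff ((0 : TorusSite 1 (2 * M)), (fun j => ((![-(v ω) 1, (v ω) 0] j : ℤ) : ZMod L))))^[2] (fun q : TorusSite 1 (2 * M) × TorusSite 2 L => F ω (⟨(q.1 0).val, ZMod.val_lt (q.1 0)⟩, q.2) * F ω' (⟨(q.1 0).val, ZMod.val_lt (q.1 0)⟩, q.2)) q‖ ≤
      α₂ * ‖(WithLp.toLp 2 (fun j => 2 * π / L * ((![-(v ω) 1, (v ω) 0] : Fin 2 → ℤ) j : ℝ)) : EuclideanSpace ℝ (Fin 2))‖ ^ 2)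
    (hMn₃ : ∀ ω ω' q, ‖(fwdDiff ((0 : TorusSite 1 (2 * M)), (fun j => ((![-(v ω) 1, (v ω) 0] j : ℤ) : ZMod L))))^[3] (fun q : TorusSite 1 (2 * M) × TorusSite 2 L => F ω (⟨(q.1 0).val, ZMod.val_lt (q.1 0)⟩, q.2) * F ω' (⟨(q.1 0).val, ZMod.val_lt (q.1 0)⟩, q.2)) q‖ ≤
      α₃ * ‖(WithLp.toLp 2 (fun j => 2 * π / L * ((![-(v ω) 1, (v ω) 0] : Fin 2 → ℤ) j : ℝ)) : EuclideanSpace ℝ (Fin 2))‖ ^ 3)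
    (hMv₁ : ∀ ω ω' q, ‖fwdDiff ((0 : TorusSite 1 (2 * M)), (fun j => (((v ω) j : ℤ) : ZMod L))) (fun q : TorusSite 1 (2 * M) × TorusSite 2 L => F ω (⟨(q.1 0).val, ZMod.val_lt (q.1 0)⟩, q.2) * F ω' (⟨(q.1 0).val, ZMod.val_lt (q.1 0)⟩, q.2)) q‖ ≤
      α₁ * ‖(WithLp.toLp 2 (fun j => 2 * π / L * ((v ω) j : ℝ)) : EuclideanSpace ℝ (Fin 2))‖)
    (hMv₂ : ∀ ω ω' q, ‖(fwdDiff ((0 : TorusSite 1 (2 * M)), (fun j => (((v ω) j : ℤ) : ZMod L))))^[2] (fun q : TorusSite 1 (2 * M) × TorusSite 2 L => F ω (⟨(q.1 0).val, ZMod.val_lt (q.1 0)⟩, q.2) * F ω' (⟨(q.1 0).val, ZMod.val_lt (q.1 0)⟩, q.2)) q‖ ≤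
      α₂ * ‖(WithLp.toLp 2 (fun j => 2 * π / L * ((v ω) j : ℝ)) : EuclideanSpace ℝ (Fin 2))‖ ^ 2)
    (hMv₃ : ∀ ω ω' q, ‖(fwdDiff ((0 : TorusSite 1 (2 * M)), (fun j => (((v ω) j : ℤ) : ZMod L))))^[3] (fun q : TorusSite 1 (2 * M) × TorusSite 2 L => F ω (⟨(q.1 0).val, ZMod.val_lt (q.1 0)⟩, q.2) * F ω' (⟨(q.1 0).val, ZMod.val_lt (q.1 0)⟩, q.2)) q‖ ≤
      α₃ * ‖(WithLp.toLp 2 (fun j => 2 * π / L * ((v ω) j : ℝ)) : EuclideanSpace ℝ (Fin 2))‖ ^ 3)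
    -- the level's weight rates `s₀, S`, the piece rates `ρ, ρ₃`, the time condition, the thresholds AT `m₀`, the rate conditions
    {s₀ S ρ ρ₃ k₁ k₂ k₃ k₄ : ℝ} (hs₀ : 0 < s₀) (hρ : 0 < ρ) (hρ₃ : 0 < ρ₃) (hSρ : ρ ≤ S * (4 : ℝ) ^ m₀)
    (hk₁ : k₁ = (16 * B₁ + 16) / Λ ^ 2) (hk₂ : k₂ = (32 * B₂ + 144 * B₁ + 128) / Λ ^ 3)
    (hk₃ : k₃ = (64 * B₃ + 480 * B₂ + 1728 * B₁ + 1536) / Λ ^ 4)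
    (hk₄ : k₄ = (128 * B₄ + 1408 * B₃ + 7776 * B₂ + 27648 * B₁ + 24576) / Λ ^ 5)
    (ht : (2 * π / β) ^ 3 * ((128 * B₄ + 1216 * B₃ + 6912 * B₂ + 26112 * B₁ + 24576) * (β * (L : ℝ) ^ 2) / Λ ^ 5) +
          3 * (at₁ * ((2 * π / β) ^ 2 * ((64 * B₃ + 416 * B₂ + 1600 * B₁ + 1536) * (β * (L : ℝ) ^ 2) / Λ ^ 4))) +
          3 * (at₂ * ((2 * π / β) * ((32 * B₂ + 128 * B₁ + 128) * (β * (L : ℝ) ^ 2) / Λ ^ 3))) + at₃ * ((16 * B₁ + 16) * (β * (L : ℝ) ^ 2) / Λ ^ 2) ≤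
      2 * ((16 * B₁ + 16) * (β * (L : ℝ) ^ 2) / Λ ^ 2) * (4 / (s₀ * (2 * M : ℕ))) ^ 3)
    (hX1 : 3 * (3 * G₁ * k₂ * b₂' + 3 * G₂ * k₁ * α₁ + 3 * G₂ * k₂ * b₁) ≤ k₁ * G₃ * (4 : ℝ) ^ m₀)
    (hX2 : 3 * (3 * G₀ * k₂ * α₁ * b₂' + 3 * G₀ * k₃ * b₁ * b₂' + 6 * G₁ * k₂ * α₁ * b₁ + 3 * G₁ * k₃ * b₁ ^ 2 + G₀ * G₃ * k₂ + G₀ * k₂ * b₃' + 3 * G₁ * G₂ * k₂ + 3 * G₁ * k₁ * α₂ + 3 * G₁ * k₂ * b₂) ≤ k₁ * G₃ * ((4 : ℝ) ^ m₀) ^ 2)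
    (hX3 : 3 * ((3 * G₀ * k₃ * α₁ * b₁ ^ 2 + G₀ * k₄ * b₁ ^ 3 + 3 * G₀ * G₁ * k₃ * b₂' + 3 * G₀ * G₂ * k₂ * α₁ + 3 * G₀ * G₂ * k₃ * b₁ + 3 * G₀ * k₂ * α₁ * b₂ + 3 * G₀ * k₂ * α₂ * b₁ + 3 * G₀ * k₃ * b₁ * b₂ + 3 * G₁ ^ 2 * k₂ * α₁ + 3 * G₁ ^ 2 * k₃ * b₁ + G₀ * k₁ * α₃ + G₀ * k₂ * b₃) + (6 * G₀ * G₁ * k₃ * α₁ * b₁ + 3 * G₀ * G₁ * k₄ * b₁ ^ 2 + 3 * G₀ * G₁ * G₂ * k₃ + 3 * G₀ * G₁ * k₂ * α₂ + 3 * G₀ * G₁ * k₃ * b₂ + G₁ ^ 3 * k₃) + (3 * G₀ * G₁ ^ 2 * k₃ * α₁ + 3 * G₀ * G₁ ^ 2 * k₄ * b₁) + (G₀ * G₁ ^ 3 * k₄)) ≤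
      k₁ * G₃ * ((4 : ℝ) ^ m₀) ^ 3)
    (hY1 : 2 * (G₀ * k₂ * b₂' + 2 * G₁ * k₁ * α₁ + 2 * G₁ * k₂ * b₁) ≤ k₁ * G₂ * (4 : ℝ) ^ m₀)
    (hY2 : 2 * ((2 * G₀ * k₂ * α₁ * b₁ + G₀ * k₃ * b₁ ^ 2 + G₀ * G₂ * k₂ + G₀ * k₁ * α₂ + G₀ * k₂ * b₂ + G₁ ^ 2 * k₂) + (2 * G₀ * G₁ * k₂ * α₁ + 2 * G₀ * G₁ * k₃ * b₁) + (G₀ * G₁ ^ 2 * k₃)) ≤ k₁ * G₂ * ((4 : ℝ) ^ m₀) ^ 2)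
    (hrate₃ : G₃ * ρ ^ 3 ≤ (2 / π) ^ 3 * G₀) (hrate₂ : G₂ * ρ₃ ^ 2 ≤ (2 / π) ^ 2 * G₀)
    (Y : SpaceTimeIdx L M × SectorLeg N) :
    ∑ Y' : SpaceTimeIdx L M × SectorLeg N,
        ‖((sectorSubMatrix L M β F).transpose * hubbardCovSliceCT L M β μ 0 (klFlowFrameU L M β U μ (m₀ + d)) Λ Λ' *
            sectorSubMatrix L M β F) Y Y'‖ *
          (1 + s₀ * |(((((fun _ : Fin 1 => ((Y.1.1 : ℕ) : ZMod (2 * M)) - ((Y'.1.1 : ℕ) : ZMod (2 * M))) : TorusSite 1 (2 * M)) 0).valMinAbs : ℤ) : ℝ)| +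
            S * |((((Y.1.2 - Y'.1.2) 0).valMinAbs : ℤ) : ℝ)| + S * |((((Y.1.2 - Y'.1.2) 1).valMinAbs : ℤ) : ℝ)|) ≤
      8 * ∑ ω' : Fin N, ∑ z : TorusSite 1 (2 * M) × TorusSite 2 L, (1 + s₀ * |(((z.1 0).valMinAbs : ℤ) : ℝ)| + S * |(((z.2 0).valMinAbs : ℤ) : ℝ)| + S * |(((z.2 1).valMinAbs : ℤ) : ℝ)|) *
        ‖∑ q : TorusSite 1 (2 * M) × TorusSite 2 L, (torusChar q.1 z.1 * torusChar q.2 z.2) •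
          ((((1 / (β * (L : ℝ) ^ 2) : ℝ) : ℂ) ^ 2 *
            (F Y.2.1.1 (⟨(q.1 0).val, ZMod.val_lt (q.1 0)⟩, q.2) * F ω' (⟨(q.1 0).val, ZMod.val_lt (q.1 0)⟩, q.2) *
              sliceSymbolFnXi (β * (L : ℝ) ^ 2) 0 Λ Λ' (matsubaraFreq β M ⟨(q.1 0).val, ZMod.val_lt (q.1 0)⟩)
                (nambuXiCT L μ (klFlowFrameU L M β U μ m₀) q.2))))‖ +
      (d : ℝ) * (8 * ∑ ω' : Fin N, S / ρ * Real.sqrt (524288 * (1 / s₀ + 1) * ((1 + 4 * Real.sqrt 2) ^ 2 * ((2 * Real.sqrt 2 / ρ + 2) * (2 * Real.sqrt 2 / ρ₃ + 2)) + (1 / ρ + 1) ^ 2)) *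
        Real.sqrt (24 * (2 * M : ℕ) * (L : ℝ) ^ 2 * Ns Y.2.1.1 ω') * (2 * ((1 / (β * (L : ℝ) ^ 2)) ^ 2 * ((16 * B₁ + 16) * (β * (L : ℝ) ^ 2) / Λ ^ 2 * G₀)))) := by
  classical
  have hS : 0 < S := by
    have h4 : (0 : ℝ) < (4 : ℝ) ^ m₀ := by positivity
    nlinarith only [hρ, hSρ, h4]
  set w : TorusSite 1 (2 * M) × TorusSite 2 L → ℝ := fun z => (1 + s₀ * |(((z.1 0).valMinAbs : ℤ) : ℝ)| + S * |(((z.2 0).valMinAbs : ℤ) : ℝ)| + S * |(((z.2 1).valMinAbs : ℤ) : ℝ)|) with hwdef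
  have hw0 : ∀ z, 0 ≤ w z := fun z => momentWt_nonneg hs₀.le hS.le z
  have hw : ∀ a b, w (-a, -b) = w (a, b) := fun a b => momentWt_neg s₀ S a b
  have htel := rowSumWt_norm_sectorSliceCT_le_telescope hβ.ne' μ Λ Λ' F (fun i => klFlowFrameU L M β U μ i) m₀ d w hw0 hw Y
  refine htel.trans (add_le_add le_rfl ?_)
  -- each increment costs the same `m`-free amount
  have hpiece : ∀ i ∈ range d, 8 * ∑ ω' : Fin N, ∑ z : TorusSite 1 (2 * M) × TorusSite 2 L, w z *
        ‖∑ q : TorusSite 1 (2 * M) × TorusSite 2 L, (torusChar q.1 z.1 * torusChar q.2 z.2) •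
          ((((1 / (β * (L : ℝ) ^ 2) : ℝ) : ℂ) ^ 2 *
            (F Y.2.1.1 (⟨(q.1 0).val, ZMod.val_lt (q.1 0)⟩, q.2) * F ω' (⟨(q.1 0).val, ZMod.val_lt (q.1 0)⟩, q.2) *
              (sliceSymbolFnXi (β * (L : ℝ) ^ 2) 0 Λ Λ' (matsubaraFreq β M ⟨(q.1 0).val, ZMod.val_lt (q.1 0)⟩)
                (nambuXiCT L μ ((fun i => klFlowFrameU L M β U μ i) (m₀ + i + 1)) q.2) -
                sliceSymbolFnXi (β * (L : ℝ) ^ 2) 0 Λ Λ' (matsubaraFreq β M ⟨(q.1 0).val, ZMod.val_lt (q.1 0)⟩)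
                (nambuXiCT L μ ((fun i => klFlowFrameU L M β U μ i) (m₀ + i)) q.2)))))‖ ≤
      8 * ∑ ω' : Fin N, S / ρ * Real.sqrt (524288 * (1 / s₀ + 1) * ((1 + 4 * Real.sqrt 2) ^ 2 * ((2 * Real.sqrt 2 / ρ + 2) * (2 * Real.sqrt 2 / ρ₃ + 2)) + (1 / ρ + 1) ^ 2)) *
        Real.sqrt (24 * (2 * M : ℕ) * (L : ℝ) ^ 2 * Ns Y.2.1.1 ω') * (2 * ((1 / (β * (L : ℝ) ^ 2)) ^ 2 * ((16 * B₁ + 16) * (β * (L : ℝ) ^ 2) / Λ ^ 2 * G₀))) := by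
    intro i hi
    rw [Finset.mem_range] at hi
    set m : ℕ := m₀ + i with hmdef
    have hm₀m : m₀ ≤ m := Nat.le_add_right _ _
    have hxm : (4 : ℝ) ^ m₀ ≤ (4 : ℝ) ^ m := pow_le_pow_right₀ (by norm_num) hm₀m
    have hx0 : (0 : ℝ) < (4 : ℝ) ^ m := by positivity
    have hJm : ∀ m' ≤ m, FlowPieceJetsAt L M β U μ R m' := fun m' hm' => hJ m' (by omega)
    have hρm : 0 < ρ / (4 : ℝ) ^ m := by positivity
    have hρS : ρ / (4 : ℝ) ^ m ≤ S := by
      rw [div_le_iff₀ hx0]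
      exact hSρ.trans (mul_le_mul_of_nonneg_left hxm hS.le)
    -- nonnegativity of the threshold sides, for the monotonicity in `m`
    have hB10 : 0 ≤ B₁ := (abs_nonneg _).trans (hB₁ 0)
    have hk₁0 : 0 ≤ k₁ := by rw [hk₁]; positivity
    have hu : ∀ j, 0 ≤ uPow j U := fun j => by unfold uPow; split_ifs <;> positivity
    have hG₂0 : 0 ≤ G₂ := by rw [hG₂]; exact mul_nonneg (hR 2) (hu 2)
    have hG₃0 : 0 ≤ G₃ := by rw [hG₃]; exact mul_nonneg (hR 3) (hu 3)
    have hX1m : 3 * (3 * G₁ * k₂ * b₂' + 3 * G₂ * k₁ * α₁ + 3 * G₂ * k₂ * b₁) ≤ k₁ * G₃ * (4 : ℝ) ^ m := hX1.trans (by gcongr)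
    have hX2m : 3 * (3 * G₀ * k₂ * α₁ * b₂' + 3 * G₀ * k₃ * b₁ * b₂' + 6 * G₁ * k₂ * α₁ * b₁ + 3 * G₁ * k₃ * b₁ ^ 2 + G₀ * G₃ * k₂ + G₀ * k₂ * b₃' + 3 * G₁ * G₂ * k₂ + 3 * G₁ * k₁ * α₂ + 3 * G₁ * k₂ * b₂) ≤ k₁ * G₃ * ((4 : ℝ) ^ m) ^ 2 := hX2.trans (by gcongr)
    have hX3m : 3 * ((3 * G₀ * k₃ * α₁ * b₁ ^ 2 + G₀ * k₄ * b₁ ^ 3 + 3 * G₀ * G₁ * k₃ * b₂' + 3 * G₀ * G₂ * k₂ * α₁ + 3 * G₀ * G₂ * k₃ * b₁ + 3 * G₀ * k₂ * α₁ * b₂ + 3 * G₀ * k₂ * α₂ * b₁ + 3 * G₀ * k₃ * b₁ * b₂ + 3 * G₁ ^ 2 * k₂ * α₁ + 3 * G₁ ^ 2 * k₃ * b₁ + G₀ * k₁ * α₃ + G₀ * k₂ * b₃) + (6 * G₀ * G₁ * k₃ * α₁ * b₁ + 3 * G₀ * G₁ * k₄ * b₁ ^ 2 + 3 * G₀ *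 G₁ * G₂ * k₃ + 3 * G₀ * G₁ * k₂ * α₂ + 3 * G₀ * G₁ * k₃ * b₂ + G₁ ^ 3 * k₃) + (3 * G₀ * G₁ ^ 2 * k₃ * α₁ + 3 * G₀ * G₁ ^ 2 * k₄ * b₁) + (G₀ * G₁ ^ 3 * k₄)) ≤
        k₁ * G₃ * ((4 : ℝ) ^ m) ^ 3 := hX3.trans (by gcongr)
    have hY1m : 2 * (G₀ * k₂ * b₂' + 2 * G₁ * k₁ * α₁ + 2 * G₁ * k₂ * b₁) ≤ k₁ * G₂ * (4 : ℝ) ^ m := hY1.trans (by gcongr)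
    have hY2m : 2 * ((2 * G₀ * k₂ * α₁ * b₁ + G₀ * k₃ * b₁ ^ 2 + G₀ * G₂ * k₂ + G₀ * k₁ * α₂ + G₀ * k₂ * b₂ + G₁ ^ 2 * k₂) + (2 * G₀ * G₁ * k₂ * α₁ + 2 * G₀ * G₁ * k₃ * b₁) + (G₀ * G₁ ^ 2 * k₃)) ≤ k₁ * G₂ * ((4 : ℝ) ^ m) ^ 2 := hY2.trans (by gcongr)
    gcongr with ω'
    -- one pair: weight comparison, then the flow increment at its own rate
    have hincr := sliceIncrPairWt_flow_le (L := L) (M := M) hβ hΛ hΛΛ' hM hR hJm hG₀ hG₁ hG₂ hG₃ hb₁ hb₂ hb₂' hb₃ hb₃' hB₁ hB₂ hB₃ hB₄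
      (fun q : TorusSite 1 (2 * M) × TorusSite 2 L => F Y.2.1.1 (⟨(q.1 0).val, ZMod.val_lt (q.1 0)⟩, q.2) * F ω' (⟨(q.1 0).val, ZMod.val_lt (q.1 0)⟩, q.2)) (hF0 Y.2.1.1 ω') (hsupp Y.2.1.1 ω') (v Y.2.1.1) (hv Y.2.1.1)
      hat₁ hat₂ hat₃ (hMt₁ Y.2.1.1 ω') (hMt₂ Y.2.1.1 ω') (hMt₃ Y.2.1.1 ω') hα₁ hα₂ hα₃ (hMe₁ Y.2.1.1 ω') (hMe₂ Y.2.1.1 ω') (hMe₃ Y.2.1.1 ω')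
      (hMn₁ Y.2.1.1 ω') (hMn₂ Y.2.1.1 ω') (hMn₃ Y.2.1.1 ω') (hMv₁ Y.2.1.1 ω') (hMv₂ Y.2.1.1 ω') (hMv₃ Y.2.1.1 ω') hs₀ hρ hρ₃ hk₁ hk₂ hk₃ hk₄
      ht hX1m hX2m hX3m hY1m hY2m hrate₃ hrate₂
    have hcmp : ∀ z : TorusSite 1 (2 * M) × TorusSite 2 L, w z ≤ S / (ρ / (4 : ℝ) ^ m) * (1 + s₀ * |(((z.1 0).valMinAbs : ℤ) : ℝ)| + ρ / (4 : ℝ) ^ m * |(((z.2 0).valMinAbs : ℤ) : ℝ)| + ρ / (4 : ℝ) ^ m * |(((z.2 1).valMinAbs : ℤ) : ℝ)|) :=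
      fun z => momentWt_le_ratio_mul hs₀.le hρm hρS z
    calc ∑ z : TorusSite 1 (2 * M) × TorusSite 2 L, w z * _ ≤
        ∑ z : TorusSite 1 (2 * M) × TorusSite 2 L, S / (ρ / (4 : ℝ) ^ m) * (1 + s₀ * |(((z.1 0).valMinAbs : ℤ) : ℝ)| + ρ / (4 : ℝ) ^ m * |(((z.2 0).valMinAbs : ℤ) : ℝ)| + ρ / (4 : ℝ) ^ m * |(((z.2 1).valMinAbs : ℤ) : ℝ)|) * _ :=
          Finset.sum_le_sum fun z _ => mul_le_mul_of_nonneg_right (hcmp z) (norm_nonneg _)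
      _ = S / (ρ / (4 : ℝ) ^ m) * ∑ z : TorusSite 1 (2 * M) × TorusSite 2 L, (1 + s₀ * |(((z.1 0).valMinAbs : ℤ) : ℝ)| + ρ / (4 : ℝ) ^ m * |(((z.2 0).valMinAbs : ℤ) : ℝ)| + ρ / (4 : ℝ) ^ m * |(((z.2 1).valMinAbs : ℤ) : ℝ)|) * _ := by
          rw [Finset.mul_sum]
          refine Finset.sum_congr rfl fun z _ => ?_
          ring
      _ ≤ S / (ρ / (4 : ℝ) ^ m) * ((4 : ℝ) ^ m * Real.sqrt (524288 * (1 / s₀ + 1) * ((1 + 4 * Real.sqrt 2) ^ 2 * ((2 * Real.sqrt 2 / ρ + 2) * (2 * Real.sqrt 2 / ρ₃ + 2)) + (1 / ρ + 1) ^ 2)) *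
            Real.sqrt (24 * (2 * M : ℕ) * (L : ℝ) ^ 2 * Ns Y.2.1.1 ω') *
              (2 * ((1 / (β * (L : ℝ) ^ 2)) ^ 2 * ((16 * B₁ + 16) * (β * (L : ℝ) ^ 2) / Λ ^ 2 * (G₀ / ((4 : ℝ) ^ m) ^ 2))))) :=
          mul_le_mul_of_nonneg_left hincr (by positivity)
      _ = S / ρ * Real.sqrt (524288 * (1 / s₀ + 1) * ((1 + 4 * Real.sqrt 2) ^ 2 * ((2 * Real.sqrt 2 / ρ + 2) * (2 * Real.sqrt 2 / ρ₃ + 2)) + (1 / ρ + 1) ^ 2)) *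
            Real.sqrt (24 * (2 * M : ℕ) * (L : ℝ) ^ 2 * Ns Y.2.1.1 ω') * (2 * ((1 / (β * (L : ℝ) ^ 2)) ^ 2 * ((16 * B₁ + 16) * (β * (L : ℝ) ^ 2) / Λ ^ 2 * G₀))) :=
          incr_prefactor_cancel hρ.ne' hx0.ne'
  calc ∑ i ∈ range d, _ ≤ ∑ i ∈ range d, 8 * ∑ ω' : Fin N, S / ρ * Real.sqrt (524288 * (1 / s₀ + 1) * ((1 + 4 * Real.sqrt 2) ^ 2 * ((2 * Real.sqrt 2 / ρ + 2) * (2 * Real.sqrt 2 / ρ₃ + 2)) + (1 / ρ + 1) ^ 2)) *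
          Real.sqrt (24 * (2 * M : ℕ) * (L : ℝ) ^ 2 * Ns Y.2.1.1 ω') * (2 * ((1 / (β * (L : ℝ) ^ 2)) ^ 2 * ((16 * B₁ + 16) * (β * (L : ℝ) ^ 2) / Λ ^ 2 * G₀))) := Finset.sum_le_sum hpiece
    _ = _ := by rw [Finset.sum_const, card_range, nsmul_eq_mul]

end Summit.HubbardSuperconductivity.HubbardSuperconductivity.Theorems.EngineV8

end
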